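import Summits.BirchSwinnertonDyer.Rank1Residual.X2.RankOneNonsplitCertificate
import HarnessLib

/-!
# Class X2c at a SPLIT prime: the typed residue `O9.ExceptionalLeadingTermAt` is EXACT — under Mazur's
# main conjecture at the pair and the Schneider certificate it is EQUIVALENT to `BSD(E,p)`; on every
# λ-minimal split pair (`(μ_an, λ_an) = (0, 2)`) it is equivalent to `BSD(E,p)` outright
# (cell `b2b-bsdres`, unit `b2b-bsdres-eisenstein-p2`, gen 19; consumer: CLASS-CLOSURE row O9, split half)

HONEST FRAMING (run/shared/lean/b2b/bsd-rank1-residual/, verbatim in every file): the goal of the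
cell is to DELETE the COMBINATION-SHAPED residual classes of the Birch–Swinnerton-Dyer formula for
ALL analytic-rank `≤ 1` elliptic curves over `ℚ` — "full BSD formula for every rank `≤ 1` curve in
class `C`" assembled STRICTLY from published theorems — so that the rank-`≤ 1` remainder becomes
exactly the CONSTRUCTION-SHAPED classes, which are TYPED (missing-input `Prop`s), NOT attempted.
This is not "finishing BSD". Research route; NO CLAIM BEYOND STATED CLASSES; nothing here changes
a label; X2c stays CONSTRUCTION-SHAPED; `O9.ExceptionalLeadingTermAt` stays a `@[conjecture]` —
nothing about it is asserted here. Theorems only: no definition, no new named fact.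

WHAT. The CLASS-CLOSURE lane names as O9's irreducible residue the 9 502 SPLIT cells, whose closing
statement is the typed exceptional-zero rank-one leading term `O9.ExceptionalLeadingTermAt W p`
(cc-typer-6, `X2/ClassClosureO9`: Exc ∧ MC at the pair ∧ Schneider ⟹ `BSD(E,p)`). This file proves the
residue is EXACT, i.e. cannot be weakened:

* `exceptionalLeadingTermAt_iff_bsdp_of_mazurMainConjectureAt_of_schneider_split` — X2c ∧ split ∧
  MC at the pair ∧ (Schneider for THE §4.2 height at every Tate datum):
  `O9.ExceptionalLeadingTermAt W p ↔ BSDp W p` (⇐ from gen 5's exactness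
  `certificate_iff_schneider_and_bsdp_of_mazurMainConjectureAt_split`: under MC, BSD(E,p) ∧ Schneider
  give back `ord_{T=0} L = 2` and the valuation identity for EVERY admissible datum).
* `exceptionalLeadingTermAt_iff_bsdp_of_lamMin_split` — X2c ∧ split ∧ `μ_an = 0` ∧ `λ_an = 2`:
  `O9.ExceptionalLeadingTermAt W p ↔ BSDp W p` with NO further input (MC from gen 4
  `cellC_mazurMainConjectureAt_of_lamMin`, Schneider from gen 5 `schneider_and_shaIdentity_of_lamMin_split`).
* `exceptionalLeadingTermAt_iff_bsdp_of_gvPar_of_schneider_split_of_facts` — the GV-parity split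
  sub-cell (`CellCSplitGV`) with MC from registered facts (gens 16–19).

So on the split half of O9 the typed conjecture is, pair by pair and modulo the main conjecture with
its certificate, PRECISELY the `p`-part of the Birch–Swinnerton-Dyer formula — the honest reading of
"irreducible residue". References: [SteinWuthrich2013] Thm. 6.1, §4.2; [MazurTateTeitelbaum1986Invent]
§II.10; [Disegni2020] Conj. (BSD_p), Thm. 4; [Miller2011LMS] Def. 1.1, Prop. 7.6;
HOME/b2b-bsdres-eisenstein-p2/X2-GAP.md §24.
-/

set_option autoImplicit false

noncomputable section

open scoped Classical MatrixGroups ModularForm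

open PowerSeries CongruenceSubgroup WeierstrassCurve Literature.NumberTheory.EllipticCurves
  Literature.NumberTheory.EllipticCurves.ModularForms
  Literature.NumberTheory.EllipticCurves.Rank1Residual
  Literature.NumberTheory.EllipticCurves.Rank1Residual.Typed
  Literature.NumberTheory.EllipticCurves.GreenbergVatsal2000
  Literature.NumberTheory.EllipticCurves.Wuthrich2014
  Literature.NumberTheory.EllipticCurves.SteinWuthrich2013
  Literature.NumberTheory.EllipticCurves.Disegni2020
  Summit.BirchSwinnertonDyer.Rank1Residual.X2.GreenbergVatsalInputsOfFacts

namespace Summit.BirchSwinnertonDyer.Rank1Residual.X2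

variable (W : WeierstrassCurve ℚ) [W.IsElliptic] [W.IsGloballyMinimal] (p : ℕ) [Fact p.Prime]

/-- **X2c, SPLIT `p`: under Mazur's MC at the pair and the Schneider certificate, the typed exceptional
leading term IS `BSD(E,p)`** — `O9.ExceptionalLeadingTermAt W p ↔ BSDp W p`. (⇒) cc-typer-6's
`bsdp_of_cellC_of_split_of_mazurMainConjectureAt_of_exceptionalLeadingTerm`; (⇐) for every admissible
datum (cyclotomic `(κ,γ)`, newform `f`, `ϖ`, THE split Mazur–Tate–Teitelbaum `L`, Tate datum `Dq`,
canonical height `Dh`, `s = #Ш_an`), gen 5's `certificate_iff_schneider_and_bsdp_of_mazurMainConjectureAt_split`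
turns `Schneider ∧ BSD(E,p)` into `ord_{T=0} L = 2` and the valuation identity (rank `= 1` by GZK).
[cite: SteinWuthrich2013, Thm. 6.1 (p. 20) and §4.2] [cite: MazurTateTeitelbaum1986Invent, §II.10]
[cite: Miller2011LMS, Def. 1.1 and Prop. 7.6] -/
theorem exceptionalLeadingTermAt_iff_bsdp_of_mazurMainConjectureAt_of_schneider_split
    (hJs : thm61_splitMultiplicative) (hHs : exists_isSplitMultCanonical)
    (hGZ : GrossZagier1986_thm_I_7_3) (hGZK : rank_eq_analyticRank_of_analyticRank_le_one)
    (hpar : nonempty_modularParametrizationData)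
    (hc : CellC W p) (hsplit : W.HasSplitMultiplicativeReductionAtPrime p)
    (hMC : MazurMainConjectureAt W p)
    (hSch : ∀ (Dq : TateParameterData W p) (Dh : PAdicHeightData W p),
      IsSplitMultCanonical Dh Dq → SchneiderConjecture Dh) :
    O9.ExceptionalLeadingTermAt W p ↔ BSDp W p := by
  refine ⟨fun hExc ↦ bsdp_of_cellC_of_split_of_mazurMainConjectureAt_of_exceptionalLeadingTerm W p hJs
    hHs hGZ hGZK hpar hc hsplit hMC hExc hSch, fun hB ↦ ?_⟩
  intro κ γ hκ hγ hγ' N _ f hf ϖ hϖ L hL Dq Dh hDh s hs hReg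
  obtain ⟨D⟩ := W.nonempty_selmerDualData_holds κ γ hγ
  have hrank : W.mordellWeilRank = 1 := by rw [(hGZK W hc.1.le).1, hc.1]
  have hϖ0 : ϖ ≠ 0 := varpi_ne_zero_of_isNewformOf (W := W) hf hϖ
  have h := (certificate_iff_schneider_and_bsdp_of_mazurMainConjectureAt_split hJs hGZK W p hc.2.1
    hc.1.le hMC Dq hDh hκ hγ hγ' hf D ϖ hϖ0 hϖ L hL hs).mpr ⟨hSch Dq Dh hDh, hB⟩
  rw [hrank] at h
  exact h

/-- **X2c, SPLIT `p`, λ-MINIMAL (`μ_an = 0`, `λ_an = 2 = 1 + e_p`): the typed exceptional leading term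
is EQUIVALENT to `BSD(E,p)` with no further input** — Mazur's MC at the pair from λ-minimality (gen 4
`cellC_mazurMainConjectureAt_of_lamMin`) and Schneider for THE §4.2 height from gen 5
`schneider_and_shaIdentity_of_lamMin_split`. On these pairs the O9 residue is literally the `p`-part
of BSD. [cite: SteinWuthrich2013, Thm. 6.1 (p. 20) and §4.2] [cite: Wuthrich2014, Thm. 16 (p. 397)]
[cite: GreenbergVatsal2000, p. 4] [cite: MazurTateTeitelbaum1986Invent, §II.10] -/
theorem exceptionalLeadingTermAt_iff_bsdp_of_lamMin_split
    (hWu : thm16_charIdeal_dvd_multiplicative_of_reducible)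
    (hJs : thm61_splitMultiplicative) (hJn : thm61_nonsplitMultiplicative)
    (hHs : exists_isSplitMultCanonical) (hHn : exists_isMultCanonical)
    (hGZ : GrossZagier1986_thm_I_7_3) (hGZK : rank_eq_analyticRank_of_analyticRank_le_one)
    (hpar : nonempty_modularParametrizationData)
    (hc : CellC W p) (hsplit : W.HasSplitMultiplicativeReductionAtPrime p)
    (hμ0 : AnalyticMuLE W p 0) (hlam : AnalyticLambdaEq W p 2) :
    O9.ExceptionalLeadingTermAt W p ↔ BSDp W p :=
  exceptionalLeadingTermAt_iff_bsdp_of_mazurMainConjectureAt_of_schneider_split W p hJs hHs hGZ hGZK hpar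
    hc hsplit
    (cellC_mazurMainConjectureAt_of_lamMin hWu hJs hJn hHs hHn hGZK W p hc hμ0
      (fun hns ↦ absurd hsplit hns) (fun _ ↦ hlam))
    (fun Dq _ hDh ↦ (schneider_and_shaIdentity_of_lamMin_split hWu hJs hGZK hpar W p hc.2.1 hc.2.2.1
      hc.1 Dq hDh hμ0 hlam).1)

/-- **O9 sub-cell `CellCSplitGV` (split `p`, GV parity): under the Schneider certificate the typed
exceptional leading term is EQUIVALENT to `BSD(E,p)`**, Mazur's MC at the pair coming from REGISTERED
Literature facts (`mazurMainConjectureAt_of_gvPar_of_facts`). [cite: GreenbergVatsal2000, Thm. (1.3) with §2 pp. 28–30, §3 Thm. (3.11), Cor. (3.8)]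
[cite: SteinWuthrich2013, Thm. 6.1 (p. 20) and §4.2] [cite: Wuthrich2014, Thm. 16 (p. 397)] -/
theorem exceptionalLeadingTermAt_iff_bsdp_of_gvPar_of_schneider_split_of_facts
    (hT : Silverman1994_thmV53_tateUniformisation.{0})
    (hT' : Silverman1994_thmV53_corV54_tateUniformisation.{0})
    (hA : lambda_nonPrimitive_eq_add_sum_delta_multiplicative)
    (hB : datumSelmer_divisible_of_finite_torsionBy)
    (hF : datumStrictSelmer_lt_datumSelmer_of_split)
    (hG : Greenberg1999.prop510_isTorsion_hasUnitContent_of_gvPar)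
    (hLiftF : residualEpsilon_surjOn_of_lineRamifiedEven)
    (hAnF : nonPrimitive_unitContent_and_lambda_eq_residual_of_lineRamifiedEven)
    (hP : cor38_realPeriodRat_eq_unit_mul_of_isIsogenous_of_gvPar)
    (hWu : thm16_charIdeal_dvd_multiplicative_of_reducible)
    (hJs : thm61_splitMultiplicative) (hHs : exists_isSplitMultCanonical)
    (hGZ : GrossZagier1986_thm_I_7_3) (hGZK : rank_eq_analyticRank_of_analyticRank_le_one)
    (hpar : nonempty_modularParametrizationData)
    (hc : CellCSplitGV W p)
    (hSch : ∀ (Dq : TateParameterData W p) (Dh : PAdicHeightData W p),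
      IsSplitMultCanonical Dh Dq → SchneiderConjecture Dh) :
    O9.ExceptionalLeadingTermAt W p ↔ BSDp W p :=
  exceptionalLeadingTermAt_iff_bsdp_of_mazurMainConjectureAt_of_schneider_split W p hJs hHs hGZ hGZK hpar
    hc.1 hc.2.1 (mazurMainConjectureAt_of_gvPar_of_facts hT hT' hA hB hF hG hLiftF hAnF hP hWu W p
      hc.1.2.1 hc.1.2.2.2 hc.2.2) hSch

/-- **The split residue restated at the level of the lane's bookkeeping**: on a split X2c pair with
Mazur's MC and the Schneider certificate, `BSD(E,p)` FAILS iff the typed exceptional leading term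
FAILS — no statement weaker than `O9.ExceptionalLeadingTermAt` can close the pair along the cyclotomic
route, and no stronger one is needed. [cite: SteinWuthrich2013, Thm. 6.1 (p. 20) and §4.2]
[cite: MazurTateTeitelbaum1986Invent, §II.10] -/
theorem not_bsdp_iff_not_exceptionalLeadingTermAt_of_mazurMainConjectureAt_of_schneider_split
    (hJs : thm61_splitMultiplicative) (hHs : exists_isSplitMultCanonical)
    (hGZ : GrossZagier1986_thm_I_7_3) (hGZK : rank_eq_analyticRank_of_analyticRank_le_one)
    (hpar : nonempty_modularParametrizationData)
    (hc : CellC W p) (hsplit : W.HasSplitMultiplicativeReductionAtPrime p)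
    (hMC : MazurMainConjectureAt W p)
    (hSch : ∀ (Dq : TateParameterData W p) (Dh : PAdicHeightData W p),
      IsSplitMultCanonical Dh Dq → SchneiderConjecture Dh) :
    ¬ BSDp W p ↔ ¬ O9.ExceptionalLeadingTermAt W p :=
  (exceptionalLeadingTermAt_iff_bsdp_of_mazurMainConjectureAt_of_schneider_split W p hJs hHs hGZ hGZK
    hpar hc hsplit hMC hSch).not.symm

end Summit.BirchSwinnertonDyer.Rank1Residual.X2

end
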